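import Mathlib
import HarnessLib
import Literature.MathematicalPhysics.StatisticalMechanics.WeightDominatingH73

/-!
# Parameters of the dominating sequence: the trivial last step and the existence of `k₀`
# (Adams–Buchholz–Kotecký–Müller, Lemma 7.3, (7.35) "there is a constant k₀ = k₀(λ)")

Complements `WeightDominatingH73.step_of_shellBoundsV` (Lemma 7.3 at one mode for `k + 1 ≤ N`):

* `step_of_tail_zero` — beyond the last scale (`t' = 0`, no added form, `δ = 0`) the step inequality
  is `m_k/λ ≤ m_{k+1}/λ`, i.e. `derivMul_mono`;
* `shellConst_le_pow` — `S(e) ≤ #s·(π²d·L^{2e})^{M−1}` for index sets of orders `≤ M`;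
* **`exists_k0`** — the smallness hypothesis `hsmall` of `step_of_shellBoundsV` holds for all
  `e ≥ k₀ + 2` for SOME `k₀`, as soon as `B = L^{d−1+n} > L^{2(M−1)}` (i.e. `n ≥ 2M` as in
  [ABKM19] Theorem 7.1) — "(7.35) for `|p| ≥ L^{−k+k₀}` … `k₀` is independent of `L`" (here we only
  prove existence).

Everything is proved; no named fact.

## References
* S. Adams, S. Buchholz, R. Kotecký, S. Müller, arXiv:1910.13564, Lemma 7.3 (7.35) [AdamsBuchholzKoteckyMuller2019].
-/

noncomputable section

namespace Literature.MathematicalPhysics.StatisticalMechanics.GradientRG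

open Finset Real
open Literature.MathematicalPhysics.StatisticalMechanics.GradientFRD (qpow momNorm)

variable {d M : ℕ} [NeZero M]

/-- **The step beyond the last scale**: with no covariance left (`t' = 0`) and no added form (`δ = 0`)
the step inequality of `WeightData.dominated_of_multipliers` reads `m_k/λ ≤ m_{k+1}/λ`.
[cite: AdamsBuchholzKoteckyMuller2019, Lemma 7.3] -/
theorem step_of_tail_zero {L : ℝ} (hL : 1 ≤ L) {s : Finset (Fin d → ℕ)}
    (hs1 : ∀ i : Fin d, (Pi.single i 1 : Fin d → ℕ) ∈ s) {κ : Fin d → ZMod M} (hκ : κ ≠ 0)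
    {lam θ θ' : ℝ} (hlam : 0 < lam) (k : ℕ) :
    (lam * (derivMul L k s κ)⁻¹ + (1 + θ) * 0)⁻¹ + 0 * derivMul L (k + 1) s κ ≤
      (lam * (derivMul L (k + 1) s κ)⁻¹ + (1 + θ') * 0)⁻¹ := by
  have hL0 : 0 ≤ L := by linarith
  have hmk := derivMul_pos hL0 k hs1 hκ
  have hmk1 := derivMul_pos hL0 (k + 1) hs1 hκ
  have hmono := derivMul_mono hL (Nat.le_succ k) s κ
  rw [mul_zero, mul_zero, add_zero, add_zero, zero_mul, add_zero]
  refine inv_anti₀ (mul_pos hlam (inv_pos.2 hmk1)) ?_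
  exact mul_le_mul_of_nonneg_left ((inv_le_inv₀ hmk1 hmk).2 hmono) hlam.le

/-- **`S(e) ≤ #s · (π²d·L^{2e})^{M−1}`** for an index set of orders `≤ M` (`L ≥ 1`, `d ≥ 1`).
[cite: AdamsBuchholzKoteckyMuller2019, Lemma 7.3 (7.38)] -/
theorem shellConst_le_pow {s : Finset (Fin d → ℕ)} {Mord : ℕ} (hsM : ∀ α ∈ s, ∑ i, α i ≤ Mord)
    {L : ℝ} (hL : 1 ≤ L) (hd : 1 ≤ d) (e : ℕ) :
    shellConst s L e ≤ s.card * (π ^ 2 * d * L ^ (2 * e)) ^ (Mord - 1) := by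
  have hbase : 1 ≤ π * Real.sqrt d * L ^ e := by
    have h1 : (1 : ℝ) ≤ Real.sqrt d := by
      rw [show (1 : ℝ) = Real.sqrt 1 by simp]
      exact Real.sqrt_le_sqrt (by exact_mod_cast hd)
    have h2 : (1 : ℝ) ≤ L ^ e := one_le_pow₀ hL
    have h3 : (1 : ℝ) ≤ π := by linarith [Real.pi_gt_three]
    calc (1 : ℝ) = 1 * 1 * 1 := by ring
      _ ≤ π * Real.sqrt d * L ^ e := by gcongr
  have hsq : (π * Real.sqrt d * L ^ e) ^ 2 = π ^ 2 * d * L ^ (2 * e) := by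
    rw [mul_pow, mul_pow, Real.sq_sqrt (by positivity), ← pow_mul, mul_comm e 2]
  unfold shellConst
  calc ∑ α ∈ s, (π * Real.sqrt d * L ^ e) ^ (2 * (∑ i, α i - 1))
      ≤ ∑ _α ∈ s, (π ^ 2 * d * L ^ (2 * e)) ^ (Mord - 1) := by
        refine sum_le_sum fun α hα => ?_
        rw [pow_mul, hsq]
        exact pow_le_pow_right₀ (by rw [← hsq]; exact one_le_pow₀ hbase) (by have := hsM α hα; omega)
    _ = s.card * (π ^ 2 * d * L ^ (2 * e)) ^ (Mord - 1) := by rw [sum_const, nsmul_eq_mul]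

/-- **Existence of `k₀`** ([ABKM19] (7.35)): if `L ≥ 1`, `d ≥ 1`, `lam > 0`, `C ≥ 0`, all orders in `s`
are `≤ M` and `2(M−1) < d−1+n` (so `L^{2(M−1)} < B = L^{d−1+n}` once `L > 1`; for `L = 1` the claim is
about constants), then for some `k₀` the smallness hypothesis of `step_of_shellBoundsV` holds:
`∀ e ≥ k₀+2, 4·(C L^{2(d+ñ)+1})·(S(e)·dπ²) ≤ lam·B^{e+1}`.
[cite: AdamsBuchholzKoteckyMuller2019, Lemma 7.3 (7.35)] -/
theorem exists_k0 {s : Finset (Fin d → ℕ)} {Mord : ℕ} (hsM : ∀ α ∈ s, ∑ i, α i ≤ Mord)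
    {L : ℝ} (hL : 1 < L) (hd : 1 ≤ d) {n ñ : ℕ} (hn : 2 * (Mord - 1) < d - 1 + n) {lam C : ℝ}
    (hlam : 0 < lam) (hC : 0 ≤ C) :
    ∃ k₀ : ℕ, ∀ e : ℕ, k₀ + 2 ≤ e →
      4 * (C * L ^ (2 * (d + ñ) + 1)) * (shellConst s L e * (d * π ^ 2)) ≤
        lam * (L ^ (d - 1 + n)) ^ (e + 1) := by
  have hL1 : 1 ≤ L := hL.le
  have hL0 : 0 < L := by linarith
  -- `S(e) dπ² 4 Cup ≤ A q^e` with `q = (L^2)^{M-1}... `; compare with `lam B B^e`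
  set B : ℝ := L ^ (d - 1 + n) with hB
  set q : ℝ := L ^ (2 * (Mord - 1)) with hq
  set A : ℝ := 4 * (C * L ^ (2 * (d + ñ) + 1)) * (s.card * (π ^ 2 * d) ^ (Mord - 1) * (d * π ^ 2))
    with hA
  have hB0 : 0 < B := pow_pos hL0 _
  have hq0 : 0 < q := pow_pos hL0 _
  have hA0 : 0 ≤ A := by positivity
  have hqB : q / B < 1 := by
    rw [div_lt_one hB0, hq, hB]
    exact pow_lt_pow_right₀ hL hn
  have hqB0 : 0 ≤ q / B := div_nonneg hq0.le hB0.le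
  -- the bound `S(e) ≤ #s (π²d)^{M−1} q^e`
  have hS : ∀ e, shellConst s L e * (d * π ^ 2) * (4 * (C * L ^ (2 * (d + ñ) + 1))) ≤ A * q ^ e := by
    intro e
    have h1 := shellConst_le_pow hsM hL1 hd e
    have h2 : (π ^ 2 * d * L ^ (2 * e)) ^ (Mord - 1) = (π ^ 2 * d) ^ (Mord - 1) * q ^ e := by
      rw [mul_pow, hq, ← pow_mul, ← pow_mul]; ring_nf
    rw [h2] at h1
    have h3 : 0 ≤ (d : ℝ) * π ^ 2 := by positivity
    have h4 : 0 ≤ 4 * (C * L ^ (2 * (d + ñ) + 1)) := by positivity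
    calc shellConst s L e * (d * π ^ 2) * (4 * (C * L ^ (2 * (d + ñ) + 1)))
        ≤ (s.card * ((π ^ 2 * d) ^ (Mord - 1) * q ^ e)) * (d * π ^ 2) * (4 * (C * L ^ (2 * (d + ñ) + 1))) :=
          mul_le_mul_of_nonneg_right (mul_le_mul_of_nonneg_right h1 h3) h4
      _ = A * q ^ e := by rw [hA]; ring
  -- choose `k₀` with `(q/B)^{k₀} ≤ lam B / (A + 1)`
  have htarget : 0 < lam * B / (A + 1) := by positivity
  obtain ⟨k₀, hk₀⟩ := exists_pow_lt_of_lt_one htarget hqB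
  refine ⟨k₀, fun e he => ?_⟩
  -- `(q/B)^e ≤ (q/B)^{k₀}`
  have hmono : (q / B) ^ e ≤ (q / B) ^ k₀ := pow_le_pow_of_le_one hqB0 hqB.le (by omega)
  have hqe : (q / B) ^ e < lam * B / (A + 1) := lt_of_le_of_lt hmono hk₀
  -- unfold: `A q^e ≤ (A+1) q^e = (A+1) (q/B)^e B^e ≤ lam B B^e`
  have hBe : 0 < B ^ e := pow_pos hB0 _
  have h1 : (A + 1) * (q / B) ^ e ≤ lam * B := by
    have hA1 : (0 : ℝ) < A + 1 := by positivity
    have := (lt_div_iff₀ hA1).1 hqe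
    linarith [this]
  have h2 : A * q ^ e ≤ lam * B * B ^ e := by
    have hqe' : q ^ e = (q / B) ^ e * B ^ e := by
      rw [div_pow, div_mul_cancel₀ _ hBe.ne']
    rw [hqe']
    calc A * ((q / B) ^ e * B ^ e) ≤ (A + 1) * ((q / B) ^ e * B ^ e) :=
          mul_le_mul_of_nonneg_right (by linarith) (by positivity)
      _ = (A + 1) * (q / B) ^ e * B ^ e := by ring
      _ ≤ lam * B * B ^ e := mul_le_mul_of_nonneg_right h1 hBe.le
  calc 4 * (C * L ^ (2 * (d + ñ) + 1)) * (shellConst s L e * (d * π ^ 2))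
      = shellConst s L e * (d * π ^ 2) * (4 * (C * L ^ (2 * (d + ñ) + 1))) := by ring
    _ ≤ A * q ^ e := hS e
    _ ≤ lam * B * B ^ e := h2
    _ = lam * B ^ (e + 1) := by rw [pow_succ]; ring

end Literature.MathematicalPhysics.StatisticalMechanics.GradientRG

end
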